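import Summits.Ventures.DiscreteObjects.Hadamard.ConferenceGraph333CentralizingInvolutions

/-!
# No Klein four-group of Aut(srg(333,166,82,83)) commutes with an element of order `41` (kernel)

Framing: lottery ticket; floor = certified bounds/negative ranges.  Cell pub-namedobj (venture DiscreteObjects),
target (H) = `H(668)`, hadamard gen 31.  The order-`41` companion of gen 30's `no_two_involutions_centralizing_order83`:
* **`no_two_involutions_centralizing_order41`** — there are no two distinct commuting involutions `τ₁, τ₂` both commuting with an
  automorphism `ρ` of order `41`.  Proof: by `involution_centralizing_order41_fixed_one` (gen 31, resting on the involution bound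
  `f ≤ 149`) each of `τ₁, τ₂, τ₃ = τ₁τ₂` fixes exactly one vertex, necessarily the same vertex `u`, and `u ∈ Fix ρ` (`|Fix ρ| = 5`);
  the other four fixed vertices of `ρ` are `p, τ₁p, τ₂p, τ₃p` for any one of them, so `u` is adjacent to none or to all four of them:
  `Σ_{y ∈ Fix ρ} A_{uy} ∈ {0, 4}` — but a fixed vertex of `ρ` has `≡ 166 ≡ 2 (mod 41)` fixed neighbours
  (`ConferenceGraph333FixedSubgraph.aut_fixed_row_congr`; indeed `Fix ρ` induces a pentagon).
Hence the centraliser of an element of order `41` has a cyclic-or-trivial... more precisely: contains at most ONE involution among any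
set of pairwise commuting involutions, so its Sylow `2`-subgroups have a unique involution (cyclic or generalised quaternion), and there is
no subgroup `ℤ/41 × (ℤ/2)²`.  WORDS: structure of a HYPOTHETICAL object (nothing about H(668) is excluded); ours (PROVISIONAL).
No `sorry`, no new definitions.
-/

namespace Summit.Ventures.DiscreteObjects.Hadamard

open Finset

section centralizer41
variable {V : Type*} [Fintype V] [DecidableEq V]

omit [Fintype V] in
/-- a permutation with exactly one fixed point `u`: every point it fixes is `u`, and anything commuting with it fixes `u`. -/
private theorem fixed_unique_of_card_one (τ : Equiv.Perm V) [Fintype V]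
    (h : (univ.filter fun x => τ x = x).card = 1) :
    ∃ u, τ u = u ∧ (∀ y, τ y = y → y = u) ∧ (∀ g : Equiv.Perm V, g * τ = τ * g → g u = u) := by
  obtain ⟨u, hu⟩ := Finset.card_eq_one.mp h
  have hmem : ∀ y, τ y = y ↔ y = u := fun y => by
    have e : y ∈ (univ.filter fun x => τ x = x) ↔ y ∈ ({u} : Finset V) := by rw [hu]
    simpa using e
  refine ⟨u, (hmem u).mpr rfl, fun y hy => (hmem y).mp hy, fun g hg => (hmem (g u)).mp ?_⟩
  have e := congrArg (fun f : Equiv.Perm V => f u) hg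
  simp only [Equiv.Perm.mul_apply] at e
  rw [(hmem u).mpr rfl] at e
  exact e.symm

/-- **No two distinct commuting involutions centralise an automorphism of order `41`.** -/
theorem no_two_involutions_centralizing_order41 (hV : Fintype.card V = 333) (A : Matrix V V ℤ)
    (h01 : ∀ x y, A x y = 0 ∨ A x y = 1) (hsymm : ∀ x y, A y x = A x y) (hdiag : ∀ x, A x x = 0)
    (hk : ∀ x, ∑ y, A x y = 166) (hsrg : ∀ x y, ∑ z, A x z * A z y = 83 * (1 + (if x = y then 1 else 0)) - A x y)
    (ρ τ₁ τ₂ : Equiv.Perm V) (hρ : ρ ^ 41 = 1) (hρ1 : ρ ≠ 1) (h1 : τ₁ ^ 2 = 1) (h2 : τ₂ ^ 2 = 1)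
    (hτ₁ : τ₁ ≠ 1) (hτ₂ : τ₂ ≠ 1) (hne : τ₁ ≠ τ₂) (hc1 : ρ * τ₁ = τ₁ * ρ) (hc2 : ρ * τ₂ = τ₂ * ρ)
    (hc12 : τ₁ * τ₂ = τ₂ * τ₁) (hAρ : ∀ x y, A (ρ x) (ρ y) = A x y) (hA1 : ∀ x y, A (τ₁ x) (τ₁ y) = A x y)
    (hA2 : ∀ x y, A (τ₂ x) (τ₂ y) = A x y) : False := by
  -- the third involution
  have hi1 : ∀ x, τ₁ (τ₁ x) = x := fun x => by
    have := congrArg (fun g : Equiv.Perm V => g x) h1; simpa [pow_two] using this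
  have hi2 : ∀ x, τ₂ (τ₂ x) = x := fun x => by
    have := congrArg (fun g : Equiv.Perm V => g x) h2; simpa [pow_two] using this
  have h12x : ∀ x, τ₁ (τ₂ x) = τ₂ (τ₁ x) := fun x => by
    have := congrArg (fun g : Equiv.Perm V => g x) hc12; simpa using this
  have h3 : (τ₁ * τ₂) ^ 2 = 1 := by
    ext x; simp only [pow_two, Equiv.Perm.mul_apply, Equiv.Perm.one_apply]
    rw [h12x x, hi2, hi1]
  have hτ₃ : τ₁ * τ₂ ≠ 1 := fun h => hne (by
    have : τ₁ = τ₂⁻¹ := eq_inv_of_mul_eq_one_left h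
    rw [this]; ext x
    simp only [Equiv.Perm.inv_def, Equiv.symm_apply_eq]; exact (hi2 x).symm)
  have hc3 : ρ * (τ₁ * τ₂) = (τ₁ * τ₂) * ρ := by rw [← mul_assoc, hc1, mul_assoc, hc2, mul_assoc]
  have hA3 : ∀ x y, A ((τ₁ * τ₂) x) ((τ₁ * τ₂) y) = A x y := fun x y => by
    rw [Equiv.Perm.mul_apply, Equiv.Perm.mul_apply, hA1, hA2]
  -- each fixes exactly one vertex, the same vertex u ∈ Fix ρ
  obtain ⟨f1, -⟩ := involution_centralizing_order41_fixed_one hV A h01 hsymm hdiag hk hsrg ρ τ₁ hρ hρ1 h1 hτ₁ hc1 hAρ hA1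
  obtain ⟨f2, -⟩ := involution_centralizing_order41_fixed_one hV A h01 hsymm hdiag hk hsrg ρ τ₂ hρ hρ1 h2 hτ₂ hc2 hAρ hA2
  obtain ⟨f3, -⟩ :=
    involution_centralizing_order41_fixed_one hV A h01 hsymm hdiag hk hsrg ρ (τ₁ * τ₂) hρ hρ1 h3 hτ₃ hc3 hAρ hA3
  obtain ⟨u, hu1, huniq1, hcomm1⟩ := fixed_unique_of_card_one τ₁ f1
  have hu2 : τ₂ u = u := hcomm1 τ₂ hc12.symm
  have huρ : ρ u = u := hcomm1 ρ hc1
  have hu3 : (τ₁ * τ₂) u = u := by rw [Equiv.Perm.mul_apply, hu2, hu1]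
  obtain ⟨u2, hu2', huniq2, -⟩ := fixed_unique_of_card_one τ₂ f2
  have e2 : u2 = u := (huniq2 u hu2) ▸ rfl
  obtain ⟨u3, hu3', huniq3, -⟩ := fixed_unique_of_card_one (τ₁ * τ₂) f3
  have e3 : u3 = u := (huniq3 u hu3) ▸ rfl
  -- Fix ρ has 5 elements; pick p ≠ u in it
  obtain ⟨-, -, -, -, -, -, -, -, w41, -⟩ :=
    aut_prime_windows_refined hV A h01 hsymm hdiag hk hsrg (by norm_num : Nat.Prime 41) (by norm_num) ρ hρ hρ1 hAρ
  have hF5 : (univ.filter fun x => ρ x = x).card = 5 := w41 rfl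
  have huF : u ∈ (univ.filter fun x => ρ x = x) := Finset.mem_filter.mpr ⟨Finset.mem_univ _, huρ⟩
  obtain ⟨p, hp⟩ : ((univ.filter fun x => ρ x = x).erase u).Nonempty := by
    rw [← Finset.card_pos, Finset.card_erase_of_mem huF, hF5]; norm_num
  obtain ⟨hpu, hpF⟩ := Finset.mem_erase.mp hp
  have hρp : ρ p = p := (Finset.mem_filter.mp hpF).2
  -- the V₄-orbit of p inside Fix ρ
  have hρτ1 : ∀ x, ρ x = x → ρ (τ₁ x) = τ₁ x := fun x hx => by
    have := congrArg (fun g : Equiv.Perm V => g x) hc1; simp only [Equiv.Perm.mul_apply] at this; rw [hx] at this; exact this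
  have hρτ2 : ∀ x, ρ x = x → ρ (τ₂ x) = τ₂ x := fun x hx => by
    have := congrArg (fun g : Equiv.Perm V => g x) hc2; simp only [Equiv.Perm.mul_apply] at this; rw [hx] at this; exact this
  have n1 : τ₁ p ≠ p := fun h => hpu (huniq1 p h)
  have n2 : τ₂ p ≠ p := fun h => hpu (by rw [← e2]; exact huniq2 p h)
  have n3 : τ₁ (τ₂ p) ≠ p := fun h => hpu (by rw [← e3]; exact huniq3 p (by rw [Equiv.Perm.mul_apply]; exact h))
  have n1u : τ₁ p ≠ u := fun h => hpu (by rw [← hi1 p, h, hu1])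
  have n2u : τ₂ p ≠ u := fun h => hpu (by rw [← hi2 p, h, hu2])
  have n3u : τ₁ (τ₂ p) ≠ u := fun h => n2u (by
    have := congrArg τ₁ h; rw [hi1, hu1] at this; exact this)
  have n12 : τ₁ p ≠ τ₂ p := fun h => n3 (by rw [← h, hi1])
  have n13 : τ₁ p ≠ τ₁ (τ₂ p) := fun h => n2 (τ₁.injective h).symm
  have n23 : τ₂ p ≠ τ₁ (τ₂ p) := fun h => n1u (by
    -- τ₂ p ∈ Fix τ₁ = {u} would give τ₂ p = u; instead: τ₁ (τ₂ p) = τ₂ p means τ₂ p is τ₁-fixed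
    have hfix : τ₁ (τ₂ p) = τ₂ p := h.symm
    exact absurd (huniq1 _ hfix) n2u)
  -- Fix ρ = {u, p, τ₁ p, τ₂ p, τ₁ τ₂ p}
  set F := univ.filter (fun x => ρ x = x) with hF
  have hsub : ({u, p, τ₁ p, τ₂ p, τ₁ (τ₂ p)} : Finset V) ⊆ F := by
    intro y hy
    simp only [Finset.mem_insert, Finset.mem_singleton] at hy
    rw [hF, Finset.mem_filter]
    refine ⟨Finset.mem_univ _, ?_⟩
    rcases hy with rfl | rfl | rfl | rfl | rfl
    · exact huρ
    · exact hρp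
    · exact hρτ1 p hρp
    · exact hρτ2 p hρp
    · exact hρτ1 _ (hρτ2 p hρp)
  have hm4 : τ₂ p ∉ ({τ₁ (τ₂ p)} : Finset V) := by simp [n23]
  have hm3 : τ₁ p ∉ ({τ₂ p, τ₁ (τ₂ p)} : Finset V) := by simp [n12, n13]
  have hm2 : p ∉ ({τ₁ p, τ₂ p, τ₁ (τ₂ p)} : Finset V) := by
    simp only [Finset.mem_insert, Finset.mem_singleton, not_or]; exact ⟨n1.symm, n2.symm, n3.symm⟩
  have hm1 : u ∉ ({p, τ₁ p, τ₂ p, τ₁ (τ₂ p)} : Finset V) := by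
    simp only [Finset.mem_insert, Finset.mem_singleton, not_or]; exact ⟨hpu.symm, n1u.symm, n2u.symm, n3u.symm⟩
  have hcard5 : ({u, p, τ₁ p, τ₂ p, τ₁ (τ₂ p)} : Finset V).card = 5 := by
    rw [Finset.card_insert_of_notMem hm1, Finset.card_insert_of_notMem hm2, Finset.card_insert_of_notMem hm3,
      Finset.card_insert_of_notMem hm4, Finset.card_singleton]
  have hFeq : F = {u, p, τ₁ p, τ₂ p, τ₁ (τ₂ p)} :=
    (Finset.eq_of_subset_of_card_le hsub (by rw [hF5, hcard5])).symm
  -- the fixed-neighbour sum of u is 4·A u p, but ≡ 166 (mod 41)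
  have hAup1 : A u (τ₁ p) = A u p := by conv_lhs => rw [← hu1]; exact hA1 u p
  have hAup2 : A u (τ₂ p) = A u p := by conv_lhs => rw [← hu2]; exact hA2 u p
  have hAup3 : A u (τ₁ (τ₂ p)) = A u p := by
    conv_lhs => rw [← hu1]
    rw [hA1, ← hAup2]
  have hsum : ∑ y ∈ F, A u y = 4 * A u p := by
    rw [hFeq, Finset.sum_insert hm1, Finset.sum_insert hm2, Finset.sum_insert hm3, Finset.sum_insert hm4,
      Finset.sum_singleton, hdiag, hAup1, hAup2, hAup3]
    ring
  obtain ⟨a, ha⟩ := aut_fixed_row_congr A (by norm_num : Nat.Prime 41) ρ hρ hAρ huρ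
  rw [hk u] at ha
  have hFa : ∑ y ∈ univ.filter (fun y => ρ y = y), A u y = 4 * A u p := hsum
  rw [hFa] at ha
  rcases h01 u p with h | h <;> rw [h] at ha <;> omega

end centralizer41

end Summit.Ventures.DiscreteObjects.Hadamard
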